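import Mathlib.MeasureTheory.Function.L2Space
import Mathlib.Dynamics.Ergodic.MeasurePreserving
import HarnessLib

/-!
# The reflection-positivity form on a general probability space: `L²` continuity and symmetry
(gauge-boot, L3 ↔ L1; measure-theoretic bricks)

HONEST FRAMING (cell `pub-gaugeboot`, page 1 of every file): the venture produces certified bounds
on lattice expectations at stated coupling, gauge group, dimension and torus size; NOT a mass gap,
NOT a continuum limit, NOT a string tension; NOT Yang–Mills-summit-bearing (barriers
`FixedCouplingUltralocality`, `PerturbativeInvisibility`). Pure measure theory; it certifies no number.

## Content

For a probability space `(Ω, μ)`, a `μ`-preserving map `Θ`, and bounded measurable complex `F, K`,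
the sesquilinear reflection-positivity form `B(F) = ∫ (F∘Θ)‾ F dμ` satisfies

* `RPDensity.rpForm_sub_le` — `‖B F - B K‖ ≤ ‖F - K‖₂ (‖F‖₂ + ‖K‖₂)` (Cauchy–Schwarz in `L²(μ; ℂ)`,
  `‖H∘Θ‖₂ = ‖H‖₂`): the form is continuous on bounded sets of `L²`;
* `RPDensity.integral_comp_mul_comm` — for an INVOLUTION `Θ`, the real form is symmetric:
  `∫ f(ΘU) g(U) dμ = ∫ g(ΘU) f(U) dμ`.

These are the cell's `ClassBRPClosure` lemmas (there typed for configurations on `ℤ^d`) on a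
general measurable space, for use on the torus (`BootstrapRPCutDensity.lean`).

References: K. Osterwalder, E. Seiler, Ann. Phys. 110 (1978) 440 §2; J. Glimm, A. Jaffe, Quantum
Physics (1987) §6.1. Standard.
-/

noncomputable section

open MeasureTheory
open scoped ENNReal ComplexConjugate InnerProductSpace

namespace Summit.QuantumFields.GaugeBoot

/-! ## The RP form on a general probability space: `L²` continuity -/

namespace RPDensity

variable {Ω : Type*} [MeasurableSpace Ω] {μ : Measure Ω} [IsProbabilityMeasure μ] {Θ : Ω → Ω}

omit [IsProbabilityMeasure μ] in
/-- A bounded measurable complex function on a finite measure space is in `L²`. -/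
theorem memLp_two_of_bound [IsFiniteMeasure μ] {H : Ω → ℂ} (hH : Measurable H) {C : ℝ}
    (hC : ∀ U, ‖H U‖ ≤ C) : MemLp H 2 μ :=
  MemLp.of_bound hH.aestronglyMeasurable C (ae_of_all _ hC)

omit [IsProbabilityMeasure μ] in
/-- `‖H ∘ Θ‖₂ = ‖H‖₂` for a measure-preserving `Θ`. -/
theorem eLpNorm_comp_eq (hΘ : MeasurePreserving Θ μ μ) {H : Ω → ℂ} (hH : Measurable H) :
    eLpNorm (H ∘ Θ) 2 μ = eLpNorm H 2 μ := by
  rw [← eLpNorm_map_measure (hH.aestronglyMeasurable) hΘ.measurable.aemeasurable, hΘ.map_eq]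

/-- The RP form as an `L²` inner product: `∫ (H∘Θ)‾ K dμ = ⟪H∘Θ, K⟫_{L²}`. -/
theorem integral_conj_mul_eq_inner (hΘ : MeasurePreserving Θ μ μ) {H K : Ω → ℂ}
    (hH : Measurable H) {CH : ℝ} (hCH : ∀ U, ‖H U‖ ≤ CH) (hK : Measurable K) {CK : ℝ}
    (hCK : ∀ U, ‖K U‖ ≤ CK) :
    ∫ U, conj (H (Θ U)) * K U ∂μ =
      ⟪(memLp_two_of_bound (μ := μ) (hH.comp hΘ.measurable) (C := CH) fun U => hCH (Θ U)).toLp (H ∘ Θ),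
        (memLp_two_of_bound (μ := μ) hK hCK).toLp K⟫_ℂ := by
  rw [L2.inner_def]
  refine integral_congr_ae ?_
  filter_upwards [MemLp.coeFn_toLp (memLp_two_of_bound (μ := μ) (hH.comp hΘ.measurable) (C := CH)
      fun U => hCH (Θ U)), MemLp.coeFn_toLp (memLp_two_of_bound (μ := μ) hK hCK)] with U h1 h2
  rw [h1, h2, RCLike.inner_apply', Function.comp_apply]

/-- **`L²` continuity of the RP form** on a general probability space: for bounded measurable
complex `F, K` and a `μ`-preserving `Θ`,
`‖∫ (F∘Θ)‾ F dμ - ∫ (K∘Θ)‾ K dμ‖ ≤ ‖F - K‖₂ (‖F‖₂ + ‖K‖₂)`. [folklore] -/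
theorem rpForm_sub_le (hΘ : MeasurePreserving Θ μ μ) {F K : Ω → ℂ} (hF : Measurable F)
    {CF : ℝ} (hCF : ∀ U, ‖F U‖ ≤ CF) (hK : Measurable K) {CK : ℝ} (hCK : ∀ U, ‖K U‖ ≤ CK) :
    ‖(∫ U, conj (F (Θ U)) * F U ∂μ) - ∫ U, conj (K (Θ U)) * K U ∂μ‖ ≤
      (eLpNorm (F - K) 2 μ).toReal * ((eLpNorm F 2 μ).toReal + (eLpNorm K 2 μ).toReal) := by
  have hFm : MemLp F 2 μ := memLp_two_of_bound hF hCF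
  have hKm : MemLp K 2 μ := memLp_two_of_bound hK hCK
  have hFΘm : MemLp (F ∘ Θ) 2 μ :=
    memLp_two_of_bound (hF.comp hΘ.measurable) (C := CF) fun U => hCF (Θ U)
  have hKΘm : MemLp (K ∘ Θ) 2 μ :=
    memLp_two_of_bound (hK.comp hΘ.measurable) (C := CK) fun U => hCK (Θ U)
  rw [integral_conj_mul_eq_inner hΘ hF hCF hF hCF, integral_conj_mul_eq_inner hΘ hK hCK hK hCK]
  set a := hFΘm.toLp (F ∘ Θ)
  set b := hFm.toLp F
  set a' := hKΘm.toLp (K ∘ Θ)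
  set b' := hKm.toLp K
  have hsplit : ⟪a, b⟫_ℂ - ⟪a', b'⟫_ℂ = ⟪a - a', b⟫_ℂ + ⟪a', b - b'⟫_ℂ := by
    rw [inner_sub_left, inner_sub_right]; ring
  have ha : ‖a - a'‖ = (eLpNorm (F - K) 2 μ).toReal := by
    rw [show a - a' = (hFΘm.sub hKΘm).toLp (F ∘ Θ - K ∘ Θ) from (MemLp.toLp_sub hFΘm hKΘm).symm,
      Lp.norm_toLp, show (F ∘ Θ - K ∘ Θ : Ω → ℂ) = (F - K) ∘ Θ from rfl,
      eLpNorm_comp_eq hΘ (hF.sub hK)]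
  have hb : ‖b - b'‖ = (eLpNorm (F - K) 2 μ).toReal := by
    rw [show b - b' = (hFm.sub hKm).toLp (F - K) from (MemLp.toLp_sub hFm hKm).symm, Lp.norm_toLp]
  have hb0 : ‖b‖ = (eLpNorm F 2 μ).toReal := Lp.norm_toLp _ _
  have ha' : ‖a'‖ = (eLpNorm K 2 μ).toReal := by
    rw [Lp.norm_toLp, eLpNorm_comp_eq hΘ hK]
  rw [hsplit]
  calc ‖⟪a - a', b⟫_ℂ + ⟪a', b - b'⟫_ℂ‖ ≤ ‖⟪a - a', b⟫_ℂ‖ + ‖⟪a', b - b'⟫_ℂ‖ := norm_add_le _ _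
    _ ≤ ‖a - a'‖ * ‖b‖ + ‖a'‖ * ‖b - b'‖ :=
        add_le_add (norm_inner_le_norm _ _) (norm_inner_le_norm _ _)
    _ = (eLpNorm (F - K) 2 μ).toReal * ((eLpNorm F 2 μ).toReal + (eLpNorm K 2 μ).toReal) := by
        rw [ha, hb, hb0, ha']; ring

omit [IsProbabilityMeasure μ] in
/-- **Symmetry of the real form for a measure-preserving involution**:
`∫ f(ΘU) g(U) dμ = ∫ g(ΘU) f(U) dμ`. -/
theorem integral_comp_mul_comm (hΘ : MeasurePreserving Θ μ μ) (hΘΘ : ∀ U, Θ (Θ U) = U)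
    {f g : Ω → ℝ} (hf : Measurable f) (hg : Measurable g) :
    ∫ U, f (Θ U) * g U ∂μ = ∫ U, g (Θ U) * f U ∂μ := by
  have h := integral_map (μ := μ) hΘ.measurable.aemeasurable (f := fun V => g (Θ V) * f V)
    ((hg.comp hΘ.measurable).mul hf).aestronglyMeasurable
  rw [hΘ.map_eq] at h
  rw [h]
  refine integral_congr_ae (ae_of_all _ fun U => ?_)
  simp only [hΘΘ, mul_comm]

end RPDensity

end Summit.QuantumFields.GaugeBoot

end
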